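import Summits.ResolutionOfSingularities.ResolutionOfSingularities.Theorems.HilbertSamuelEliminationSigmaMaxModificationsCorridor3TameValueHypersurface
import Literature.AlgebraicGeometry.Resolution.RegularLocalRingsQuotient
import HarnessLib

/-!
# Route `HilbertSamuelElimination`, crux `SigmaMaxModificationsCorridor3`
# (stmt-ResolutionOfSingularities-19249; child of `SigmaMaxModifications` stmt-…-18506),
# line `tame_wild`, helper H1⁺ of `stub_tameNu3`: cutting the superfluous parameters

[OURS · L1 W4.2] The CUTTING step that turns helper H1 (`…Corridor3TameValueHypersurface.lean`,
`stub_H1_hypersurface_of_hilbertFun`: regular ambient of dimension EQUAL to the embedding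
dimension) into the form step (1) of `stub_tameNu3` consumes (`L/w42/CRUX-PLAN.md` v1 §2, "USE of
H1": "`𝒪_{Y,y}` is a quotient of the regular `𝒪_{𝔸ⁿ,y}` ⇒ after cutting by the `n - e`
superfluous parameters `𝒪_{Y,y} ≅ 𝒪_{Z,y}/(g)`, `Z` regular of dimension `ψ+1`, `ord g = m`").
NOT a statement of any manuscript.

**Theorem (ring level, regular ambient of ANY dimension).** Let `S` be a regular local ring,
`f : S → A` a surjection onto a local ring whose Hilbert function is that of a hypersurface of
multiplicity `m ≥ 2` in embedding dimension `e`
(`H^{(0)}_A(n) + Φ^{(e)}(n-m)·[m ≤ n] = Φ^{(e)}(n)`, equivalently `hilbertFun A = hypersurfaceHFe e m`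
for `e ≥ 1`). Then there are an ideal `J ⊆ ker f` with `S/J` a REGULAR local ring of dimension
`e` and an element `g ∈ 𝔪_S^m` with `g ∉ 𝔪_S^{m+1} + J` (i.e. of order exactly `m` in `S/J`) such
that `ker f = J + (g)`: `A ≅ (S/J)/(ḡ)` — `exists_regular_quotient_of_hilbertFun`,
`exists_regular_quotient_of_hilbertFun_eq_hypersurfaceHFe`, and at a point of a Hilbert–Samuel
stratum `exists_regular_quotient_of_mem_hsStratum` (ANY regular `S ↠ 𝒪_{Y,y}`, e.g. the local
ring of a smooth ambient scheme, is cut down to dimension `ψ_Y(y) + 1`).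

**Proof.** Induction on `dim S - e` (`cut_aux`). If `dim S = e` this is H1
(`eq_span_singleton_of_hilbertFun_quotient`, `J = 0`). If `dim S > e = H^{(0)}_A(1)` then
`dim_k cl_1(ker f) = dim S - H^{(0)}_A(1) ≥ 1` (`finrank_initialForms_add_hilbertFun_quotient`), so
`ker f` contains an element `t` of order exactly `1` (`exists_eval_eq_of_mem_initialForms`);
`S/(t)` is regular of dimension `dim S - 1` (Matsumura Thm. 14.2,
`IsRegularLocalRing.quotient_span_singleton`) and still surjects onto `A`; apply the induction
hypothesis to `S/(t)` and pull `J₁`, `g₁` back to `S`.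

## Sources

* V. Cossart, U. Jannsen, S. Saito, *Desingularization: Invariants and Strategy*, LNM 2270
  (2020), §2.2 (p. 24, 27), Def. 2.13, Lemma 2.24. [CossartJannsenSaito2020]
* H. Matsumura, *Commutative Ring Theory* (1986), Thm. 14.2. [Matsumura1987]
-/

set_option linter.dupNamespace false -- mandated namespace of this single-conjunct summit

noncomputable section

open IsLocalRing MvPolynomial AlgebraicGeometry
open Literature.RingTheory.HilbertSamuel Literature.RingTheory.MvPolynomial
open Literature.AlgebraicGeometry.Resolution
open Summit.ResolutionOfSingularities.ResolutionOfSingularities.Theorems.SigmaMaxModificationsCorridor3.TameWild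

namespace Summit.ResolutionOfSingularities.ResolutionOfSingularities.Theorems.SigmaMaxModificationsCorridor3.Helpers

universe u v

/-! ## Arithmetic: the closed binomial form versus `Φ^{(e)}` -/

/-- For `e ≥ 1`: `hypersurfaceHFe e m n + Φ^{(e)}(n - m)·[m ≤ n] = Φ^{(e)}(n)`
(`binom(n+e-1, e-1) = binom(n+e-1, n) = Φ^{(e)}(n)`). [cite: CossartJannsenSaito2020, Def. 2.13] -/
theorem hypersurfaceHFe_add_eq_iterPSum {e : ℕ} (he : 1 ≤ e) (m n : ℕ) :
    hypersurfaceHFe e m n + (if m ≤ n then iterPSum e Phi (n - m) else 0) = iterPSum e Phi n := by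
  obtain ⟨e', rfl⟩ : ∃ e', e = e' + 1 := ⟨e - 1, by omega⟩
  rw [hypersurfaceHFe_apply, iterPSum_Phi_eq_choose, iterPSum_Phi_eq_choose]
  have h1 : n + (e' + 1) - 1 = n + e' := by omega
  have h3 : e' + 1 - 1 = e' := by omega
  simp only [h1, h3]
  split_ifs with hmn
  · have h2 : n - m + (e' + 1) - 1 = (n - m) + e' := by omega
    rw [h2, Nat.choose_symm_add (a := n - m) (b := e'), Nat.choose_symm_add (a := n) (b := e')]
    have hmono := Nat.choose_le_choose e' (show n - m + e' ≤ n + e' by omega)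
    omega
  · rw [Nat.choose_symm_add (a := n) (b := e')]
    omega

/-! ## The induction -/

/-- **Cutting, quotient form (induction on the number `r` of superfluous parameters).** `S`
regular local with `emb dim S = e + r`, `I` a proper ideal with
`H^{(0)}_{S/I}(n) + #Mon^e_{n-m}·[m ≤ n] = #Mon^e_n` (`m ≥ 1`): there are `J ≤ I` with `S/J`
regular local of dimension `e` and `g ∈ 𝔪^m ∖ (𝔪^{m+1} + J)` with `I = J + (g)`.
[cite: CossartJannsenSaito2020, §2.2 (p. 24, 27), Lemma 2.24] [cite: Matsumura1987, Thm. 14.2] -/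
theorem cut_aux : ∀ (r : ℕ) {S : Type u} [CommRing S] [IsRegularLocalRing S] {e : ℕ}
    (_hd : (maximalIdeal S).spanFinrank = e + r) (I : Ideal S) [Nontrivial (S ⧸ I)] {m : ℕ}
    (_hm : 1 ≤ m)
    (_hH : ∀ n, hilbertFun (S ⧸ I) n +
      (if m ≤ n then Nat.card (monomialsOfDegree e (n - m)) else 0) =
        Nat.card (monomialsOfDegree e n)),
    ∃ (J : Ideal S) (g : S), J ≤ I ∧ IsRegularLocalRing (S ⧸ J) ∧
      ringKrullDim (S ⧸ J) = e ∧ I = J ⊔ Ideal.span {g} ∧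
      g ∈ maximalIdeal S ^ m ∧ g ∉ maximalIdeal S ^ (m + 1) ⊔ J := by
  intro r
  induction r with
  | zero =>
    intro S _ _ e hd I _ m hm hH
    obtain ⟨x, hx⟩ := exists_span_range_eq_maximalIdeal S hd.le
    obtain ⟨g, hIg, hgm, hgm'⟩ := eq_span_singleton_of_hilbertFun_quotient hd x hx I hm hH
    have hreg : IsRegularLocalRing (S ⧸ (⊥ : Ideal S)) :=
      IsRegularLocalRing.of_ringEquiv (RingEquiv.quotientBot S).symm
    refine ⟨⊥, g, bot_le, hreg, ?_, by rw [bot_sup_eq]; exact hIg, hgm, by rwa [sup_bot_eq]⟩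
    rw [ringKrullDim_eq_of_ringEquiv (RingEquiv.quotientBot S),
      ← IsRegularLocalRing.spanFinrank_maximalIdeal (R := S), hd, Nat.add_zero]
  | succ r ih =>
    intro S _ _ e hd I _ m hm hH
    obtain ⟨x, hx⟩ := exists_span_range_eq_maximalIdeal S hd.le
    -- Step 1: `H^{(0)}_{S/I}(1) ≤ e < e + r + 1 = #Mon_1`, so `cl_1(I) ≠ 0`
    have hH1 : hilbertFun (S ⧸ I) 1 ≤ e := by
      have h := hH 1
      have hc : Nat.card (monomialsOfDegree e 1) = e := by
        rw [card_monomialsOfDegree, Nat.add_sub_cancel, Nat.choose_one_right]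
      rw [hc] at h
      omega
    have hne : initialForms x I 1 ≠ ⊥ := by
      intro hbot
      have h := finrank_initialForms_add_hilbertFun_quotient x hx I 1
      rw [hbot, finrank_bot, card_monomialsOfDegree, Nat.add_sub_cancel, Nat.choose_one_right] at h
      omega
    obtain ⟨F, hFI, hF0⟩ := Submodule.exists_mem_ne_zero_of_ne_bot hne
    -- Step 2: an element `t ∈ I` of order exactly `1`
    obtain ⟨T, -, hTI, -, ht1, ht2⟩ := exists_eval_eq_of_mem_initialForms hd x hx hFI hF0
    set t := eval x T with ht
    have ht𝔪 : t ∈ maximalIdeal S := by rwa [pow_one] at ht1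
    -- Step 3: pass to `S₁ = S/(t)`, regular of embedding dimension `e + r`
    have hKI : Ideal.span {t} ≤ I := (Ideal.span_singleton_le_iff_mem _).mpr hTI
    haveI hreg₁ : IsRegularLocalRing (S ⧸ Ideal.span {t}) :=
      (IsRegularLocalRing.quotient_span_singleton ht𝔪 ht2).1
    have hd₁ : (maximalIdeal (S ⧸ Ideal.span {t})).spanFinrank = e + r := by
      have h := spanFinrank_maximalIdeal_quotient_add_one ht𝔪 ht2
      omega
    set I₁ : Ideal (S ⧸ Ideal.span {t}) := I.map (Ideal.Quotient.mk (Ideal.span {t})) with hI₁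
    let ε : (S ⧸ Ideal.span {t}) ⧸ I₁ ≃+* S ⧸ I := DoubleQuot.quotQuotEquivQuotOfLE hKI
    haveI : Nontrivial ((S ⧸ Ideal.span {t}) ⧸ I₁) := ε.toEquiv.nontrivial
    have hHeq : hilbertFun ((S ⧸ Ideal.span {t}) ⧸ I₁) = hilbertFun (S ⧸ I) :=
      hilbertFun_eq_of_ringEquiv ε
    obtain ⟨J₁, g₁, hJ₁I₁, hregJ₁, hdimJ₁, hI₁J₁, hg₁m, hg₁⟩ :=
      ih hd₁ I₁ hm (fun n => by rw [hHeq]; exact hH n)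
    -- Step 4: pull back to `S`
    have hcomapI : I₁.comap (Ideal.Quotient.mk (Ideal.span {t})) = I := by
      rw [hI₁, Ideal.comap_map_of_surjective _ Ideal.Quotient.mk_surjective,
        ← RingHom.ker_eq_comap_bot, Ideal.mk_ker, sup_eq_left.mpr hKI]
    set J : Ideal S := J₁.comap (Ideal.Quotient.mk (Ideal.span {t})) with hJ
    have hKJ : Ideal.span {t} ≤ J := by
      intro a ha
      rw [hJ, Ideal.mem_comap, Ideal.Quotient.eq_zero_iff_mem.mpr ha]
      exact zero_mem _
    have hJmap : J.map (Ideal.Quotient.mk (Ideal.span {t})) = J₁ :=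
      Ideal.map_comap_of_surjective _ Ideal.Quotient.mk_surjective J₁
    -- lift `g₁ ∈ 𝔪₁^m` to `g ∈ 𝔪^m`
    have hg₁' : g₁ ∈ (maximalIdeal S ^ m).map (Ideal.Quotient.mk (Ideal.span {t})) := by
      rwa [Ideal.map_pow, ← maximalIdeal_quotient_eq_map]
    obtain ⟨g, hgm, hgg₁⟩ :=
      (Ideal.mem_map_iff_of_surjective _ Ideal.Quotient.mk_surjective).mp hg₁'
    -- the quotient `S/J ≅ S₁/J₁`
    let δ : S ⧸ J ≃+* (S ⧸ Ideal.span {t}) ⧸ J₁ :=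
      (DoubleQuot.quotQuotEquivQuotOfLE hKJ).symm.trans (Ideal.quotEquivOfEq hJmap)
    refine ⟨J, g, ?_, IsRegularLocalRing.of_ringEquiv δ.symm, ?_, ?_, hgm, ?_⟩
    · -- `J ≤ I`
      rw [← hcomapI]
      exact Ideal.comap_mono hJ₁I₁
    · -- `dim S/J = e`
      rw [ringKrullDim_eq_of_ringEquiv δ, hdimJ₁]
    · -- `I = J + (g)`
      refine le_antisymm (fun a ha => ?_) (sup_le ?_ ?_)
      · have ha₁ : Ideal.Quotient.mk (Ideal.span {t}) a ∈ J₁ ⊔ Ideal.span {g₁} := by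
          rw [← hI₁J₁]
          exact Ideal.mem_map_of_mem _ ha
        obtain ⟨j₁, hj₁, c₁, hc₁, hsum⟩ := Submodule.mem_sup.mp ha₁
        obtain ⟨b₁, rfl⟩ := Ideal.mem_span_singleton'.mp hc₁
        obtain ⟨b, rfl⟩ := Ideal.Quotient.mk_surjective b₁
        have hmem : a - b * g ∈ J := by
          rw [hJ, Ideal.mem_comap, map_sub, map_mul, hgg₁, ← hsum, add_sub_cancel_right]
          exact hj₁
        exact Submodule.mem_sup.mpr ⟨a - b * g, hmem, b * g,
          Ideal.mul_mem_left _ _ (Ideal.mem_span_singleton_self g), sub_add_cancel a _⟩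
      · rw [← hcomapI]
        exact Ideal.comap_mono hJ₁I₁
      · rw [Ideal.span_singleton_le_iff_mem, ← hcomapI, Ideal.mem_comap, hgg₁, hI₁J₁]
        exact Ideal.mem_sup_right (Ideal.mem_span_singleton_self g₁)
    · -- `g ∉ 𝔪^{m+1} + J`
      intro hmem
      apply hg₁
      obtain ⟨u, hu, j, hj, hsum⟩ := Submodule.mem_sup.mp hmem
      rw [← hgg₁, ← hsum, map_add]
      refine Submodule.mem_sup.mpr ⟨_, ?_, _, ?_, rfl⟩
      · rw [maximalIdeal_quotient_eq_map, ← Ideal.map_pow]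
        exact Ideal.mem_map_of_mem _ hu
      · exact hj

/-! ## The cutting theorem for a surjection `S → A` -/

/-- **Cutting the superfluous parameters (H1⁺, ring level).** `S` a regular local ring (of any
dimension), `f : S → A` a surjection onto a local ring whose Hilbert function is that of a
hypersurface of multiplicity `m ≥ 2` in embedding dimension `e`
(`H^{(0)}_A(n) + Φ^{(e)}(n - m)·[m ≤ n] = Φ^{(e)}(n)` for all `n`). Then there are `J ⊆ ker f` with
`S/J` regular local of dimension `e`, and `g ∈ 𝔪_S^m`, `g ∉ 𝔪_S^{m+1} + J`, with
`ker f = J + (g)`: `A ≅ (S/J)/(ḡ)` is a hypersurface singularity of multiplicity `m` in the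
regular local ring `S/J`. [OURS · L1 W4.2] helper of `stub_tameNu3`, step (1); NOT a statement of
the manuscript.
[cite: CossartJannsenSaito2020, §2.2 (p. 24, 27), Def. 2.13, Lemma 2.24] [cite: Matsumura1987, Thm. 14.2] -/
theorem exists_regular_quotient_of_hilbertFun {S : Type u} [CommRing S] [IsRegularLocalRing S]
    {A : Type v} [CommRing A] [IsLocalRing A] (f : S →+* A) (hf : Function.Surjective f)
    {e m : ℕ} (hm : 2 ≤ m)
    (hH : ∀ n, hilbertFun A n + (if m ≤ n then iterPSum e Phi (n - m) else 0) = iterPSum e Phi n) :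
    ∃ (J : Ideal S) (g : S), J ≤ RingHom.ker f ∧ IsRegularLocalRing (S ⧸ J) ∧
      ringKrullDim (S ⧸ J) = e ∧ RingHom.ker f = J ⊔ Ideal.span {g} ∧
      g ∈ maximalIdeal S ^ m ∧ g ∉ maximalIdeal S ^ (m + 1) ⊔ J := by
  -- `e = H_A(1) ≤ H_S(1) = emb dim S`
  have hA1 : hilbertFun A 1 = e := by
    have h := hH 1
    rw [if_neg (show ¬ m ≤ 1 by omega), add_zero, iterPSum_Phi_eq_choose, Nat.add_sub_cancel_left,
      Nat.choose_one_right] at h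
    exact h
  have hle : e ≤ (maximalIdeal S).spanFinrank := by
    letI : Algebra S A := f.toAlgebra
    have h := hilbertFun_le_of_surjective (A := S) (B := A) hf 1
    rw [hA1, hilbertFun_eq_iterPSum_Phi_of_spanFinrank_eq S rfl, iterPSum_Phi_eq_choose,
      Nat.add_sub_cancel_left, Nat.choose_one_right] at h
    exact h
  obtain ⟨r, hr⟩ := Nat.exists_eq_add_of_le hle
  haveI : Nontrivial (S ⧸ RingHom.ker f) :=
    Ideal.Quotient.nontrivial_iff.mpr (RingHom.ker_ne_top f)
  have hHA : hilbertFun (S ⧸ RingHom.ker f) = hilbertFun A :=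
    hilbertFun_eq_of_ringEquiv (RingHom.quotientKerEquivOfSurjective hf)
  exact cut_aux r hr (RingHom.ker f) (by omega) fun n => by
    rw [hHA, card_monomialsOfDegree_eq_iterPSum, card_monomialsOfDegree_eq_iterPSum]
    exact hH n

/-- **H1⁺ in the planner's closed form**: `S` regular local (any dimension), `f : S → A` a
surjection onto a local ring with `hilbertFun A = hypersurfaceHFe e m`, `e ≥ 1`, `m ≥ 2` ⟹
`ker f = J + (g)` with `S/J` regular local of dimension `e`, `g ∈ 𝔪^m ∖ (𝔪^{m+1} + J)`.
(`e ≥ 1` is needed: `hypersurfaceHFe 0 m = hypersurfaceHFe 1 m` is the Hilbert function of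
`k[t]/(t^m)`.) [OURS · L1 W4.2]; NOT a statement of the manuscript.
[cite: CossartJannsenSaito2020, §2.2 (p. 27), Def. 2.13, Lemma 2.24] [cite: Matsumura1987, Thm. 14.2] -/
theorem exists_regular_quotient_of_hilbertFun_eq_hypersurfaceHFe {S : Type u} [CommRing S]
    [IsRegularLocalRing S] {A : Type v} [CommRing A] [IsLocalRing A] (f : S →+* A)
    (hf : Function.Surjective f) {e m : ℕ} (he : 1 ≤ e) (hm : 2 ≤ m)
    (hH : hilbertFun A = hypersurfaceHFe e m) :
    ∃ (J : Ideal S) (g : S), J ≤ RingHom.ker f ∧ IsRegularLocalRing (S ⧸ J) ∧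
      ringKrullDim (S ⧸ J) = e ∧ RingHom.ker f = J ⊔ Ideal.span {g} ∧
      g ∈ maximalIdeal S ^ m ∧ g ∉ maximalIdeal S ^ (m + 1) ⊔ J :=
  exists_regular_quotient_of_hilbertFun f hf hm fun n => by
    rw [hH]
    exact hypersurfaceHFe_add_eq_iterPSum he m n

/-- **H1⁺ at a point of a Hilbert–Samuel stratum.** If `ψ_Y(y) ≤ N`, `m ≥ 2` and
`y ∈ Y(hypersurfaceHFe (N+1) m)` (at level `N = 3`: `H^3_Y(y) = hypersurfaceHF m`, a tame value),
then for EVERY surjection `f : S → 𝒪_{Y,y}` from a regular local ring `S` (of any dimension —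
e.g. `S = 𝒪_{Z,y}` for a closed immersion `Y ↪ Z` into a regular scheme) there are `J ⊆ ker f`
with `S/J` regular local of dimension `ψ_Y(y) + 1` and `g` of order exactly `m` modulo `J` with
`ker f = J + (g)`: `𝒪_{Y,y} ≅ (S/J)/(ḡ)`. [OURS · L1 W4.2] step (1) of `stub_tameNu3` at the ring
level; NOT a statement of the manuscript.
[cite: CossartJannsenSaito2020, Def. 2.28, §2.2 (p. 27), Lemma 2.24] [cite: Matsumura1987, Thm. 14.2] -/
theorem exists_regular_quotient_of_mem_hsStratum {Y : Scheme.{u}} {N m : ℕ} {y : Y}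
    (hψ : Scheme.hsPsi Y y ≤ N) (hm : 2 ≤ m)
    (hy : y ∈ Scheme.hsStratum Y N (hypersurfaceHFe (N + 1) m))
    {S : Type v} [CommRing S] [IsRegularLocalRing S] (f : S →+* Y.presheaf.stalk y)
    (hf : Function.Surjective f) :
    ∃ (J : Ideal S) (g : S), J ≤ RingHom.ker f ∧ IsRegularLocalRing (S ⧸ J) ∧
      ringKrullDim (S ⧸ J) = (Scheme.hsPsi Y y + 1 : ℕ) ∧ RingHom.ker f = J ⊔ Ideal.span {g} ∧
      g ∈ maximalIdeal S ^ m ∧ g ∉ maximalIdeal S ^ (m + 1) ⊔ J :=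
  exists_regular_quotient_of_hilbertFun_eq_hypersurfaceHFe f hf (Nat.succ_pos _) hm
    ((mem_hsStratum_hypersurfaceHFe_iff hψ).mp hy)

end Summit.ResolutionOfSingularities.ResolutionOfSingularities.Theorems.SigmaMaxModificationsCorridor3.Helpers

end
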